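import Summits.KontsevichZagierPeriods.KontsevichZagierPeriods.Theorems.PlanarAreas.Negative.Core
import Literature.NumberTheory.Transcendental.KZCalculusProofs
import Literature.NumberTheory.Transcendental.KZIntervalPeriodProofs
import Mathlib.Analysis.Calculus.Deriv.Inv

/-!
# `PlanarAreas` (stmt-KontsevichZagierPeriods-4990), line `green-native-bands`: load-bearing
# hypotheses of the Green-bulk stubs `stub_derivIntegrable` and `stub_mixedPartials` (negative lemmas)

Refuter unit `drefute-stmt-KontsevichZagierPeriods-4990` on the lead's skeleton v2
(`Cruxes/PlanarAreas/Lines/green-native-bands.lean`, stubs registered 2026-08-16T02:18Z).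

* `stub_derivIntegrable` says: for `A` continuous and `ℚ`-semialgebraic on the closed triangle `Δ`,
  the vertical fibre derivative `∂_b A` (Mathlib's `deriv`, extended by `0` off the open triangle) is
  absolutely integrable on `Δ` — TRUE on paper (fibrewise total variation `≤ 2 N ‖A‖_∞` by uniform
  finiteness of the monotonicity pieces, Tonelli). The hypothesis `ContinuousOn A Δ` cannot be
  dropped (`not_derivIntegrableWithoutContinuity`): `A = 1/y` (Lean's total `y⁻¹`, so `A = 0` on the
  edge `y = 0`) is `ℚ`-semialgebraic on `Δ`, its bulk `∂_b A = −1/y²` is `ℚ`-semialgebraic on `Δ`,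
  and `∫_Δ y⁻² = ∞` (the boxes `[¼,½] × (ε/2, ε]` carry mass `≥ 1/(8ε)`). So boundedness of `A` is
  exactly what the total-variation argument consumes.
* `stub_mixedPartials` says: for `ℚ`-semialgebraic `A, B` on `Δ` with a potential `S`
  (`dS = A da + B db` on the open triangle), off a `ℚ`-semialgebraic null set both fibre functions are
  differentiable with the same derivative — TRUE on paper (generic smoothness + Schwarz). The
  potential hypothesis cannot be dropped (`not_mixedPartialsWithoutPotential`): `A = y`, `B = 0`
  have `∂_b A = 1 ≠ 0 = ∂_a B` at every point, and a null `Z` misses a point of the open triangle.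
-/

noncomputable section

open Set MeasureTheory MvPolynomial Filter Topology
open scoped ENNReal
open Literature.NumberTheory.Transcendental Literature.ModelTheory.ExponentialFields

namespace Summit.KontsevichZagierPeriods.PlanarAreas.Negative.GreenBands

/-- `stub_derivIntegrable` with the hypothesis `ContinuousOn A Δ` DELETED (verbatim otherwise). -/
def DerivIntegrableWithoutContinuity : Prop := ∀ A : (Fin 2 → ℝ) → ℝ,
    IsSemialgebraicFunOn ℚ {p : Fin 2 → ℝ | 0 ≤ p 0 ∧ 0 ≤ p 1 ∧ p 0 + p 1 ≤ 1} A →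
    IsSemialgebraicFunOn ℚ {p : Fin 2 → ℝ | 0 ≤ p 0 ∧ 0 ≤ p 1 ∧ p 0 + p 1 ≤ 1}
      (fun p => if 0 < p 0 ∧ 0 < p 1 ∧ p 0 + p 1 < 1
        then deriv (fun s : ℝ => A ![p 0, s]) (p 1) else 0) →
    IntegrableOn (fun p => if 0 < p 0 ∧ 0 < p 1 ∧ p 0 + p 1 < 1
        then deriv (fun s : ℝ => A ![p 0, s]) (p 1) else 0)
      {p : Fin 2 → ℝ | 0 ≤ p 0 ∧ 0 ≤ p 1 ∧ p 0 + p 1 ≤ 1} volume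

/-! ## The closed and the open triangle -/

/-- The closed standard triangle is `ℚ`-semialgebraic (same statement as
`CurvePeriodsTransferNegative.isSemialgebraic_stdTriangle` in
`Theorems/CurvePeriodsTransfer/Negative/IntegrandAddViaGreen.lean`, which is not imported here because
that module was stale/unbuilt on the farm at submission time). -/
theorem isSemialgebraic_closedTriangle' :
    IsSemialgebraic ℚ {p : Fin 2 → ℝ | 0 ≤ p 0 ∧ 0 ≤ p 1 ∧ p 0 + p 1 ≤ 1} := by
  have h0 : IsSemialgebraic ℚ {x : Fin 2 → ℝ | 0 ≤ x 0} := by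
    simpa using isSemialgebraic_setOf_eval_le (k := ℚ) (R := ℝ) (ι := Fin 2) (C 0) (X 0)
  have h1 : IsSemialgebraic ℚ {x : Fin 2 → ℝ | 0 ≤ x 1} := by
    simpa using isSemialgebraic_setOf_eval_le (k := ℚ) (R := ℝ) (ι := Fin 2) (C 0) (X 1)
  have h2 : IsSemialgebraic ℚ {x : Fin 2 → ℝ | x 0 + x 1 ≤ 1} := by
    have e : {x : Fin 2 → ℝ | x 0 + x 1 ≤ 1} = {x : Fin 2 → ℝ |
        aeval x (X 0 + X 1 : MvPolynomial (Fin 2) ℚ) ≤ aeval x (C 1 : MvPolynomial (Fin 2) ℚ)} := by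
      ext x
      simp only [mem_setOf_eq, map_add, MvPolynomial.aeval_X, map_one]
    rw [e]
    exact isSemialgebraic_setOf_eval_le _ _
  have hEq : {p : Fin 2 → ℝ | 0 ≤ p 0 ∧ 0 ≤ p 1 ∧ p 0 + p 1 ≤ 1} =
      {x : Fin 2 → ℝ | 0 ≤ x 0} ∩ ({x : Fin 2 → ℝ | 0 ≤ x 1} ∩ {x : Fin 2 → ℝ | x 0 + x 1 ≤ 1}) := by
    ext p; simp
  rw [hEq]
  exact h0.inter (h1.inter h2)


/-- The open standard triangle is `ℚ`-semialgebraic. -/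
theorem isSemialgebraic_openTriangle :
    IsSemialgebraic ℚ {p : Fin 2 → ℝ | 0 < p 0 ∧ 0 < p 1 ∧ p 0 + p 1 < 1} := by
  have h0 : IsSemialgebraic ℚ {x : Fin 2 → ℝ | 0 < x 0} := by
    simpa using isSemialgebraic_setOf_eval_lt (k := ℚ) (R := ℝ) (ι := Fin 2) (C 0) (X 0)
  have h1 : IsSemialgebraic ℚ {x : Fin 2 → ℝ | 0 < x 1} := by
    simpa using isSemialgebraic_setOf_eval_lt (k := ℚ) (R := ℝ) (ι := Fin 2) (C 0) (X 1)
  have h2 : IsSemialgebraic ℚ {x : Fin 2 → ℝ | x 0 + x 1 < 1} := by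
    have e : {x : Fin 2 → ℝ | x 0 + x 1 < 1} = {x : Fin 2 → ℝ |
        aeval x (X 0 + X 1 : MvPolynomial (Fin 2) ℚ) < aeval x (C 1 : MvPolynomial (Fin 2) ℚ)} := by
      ext x
      simp only [mem_setOf_eq, map_add, MvPolynomial.aeval_X, map_one]
    rw [e]
    exact isSemialgebraic_setOf_eval_lt _ _
  have hEq : {p : Fin 2 → ℝ | 0 < p 0 ∧ 0 < p 1 ∧ p 0 + p 1 < 1} =
      {x : Fin 2 → ℝ | 0 < x 0} ∩ ({x : Fin 2 → ℝ | 0 < x 1} ∩ {x : Fin 2 → ℝ | x 0 + x 1 < 1}) := by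
    ext p; simp
  rw [hEq]
  exact h0.inter (h1.inter h2)

/-! ## The witness `A = 1/y` and its bulk `−1/y²` -/

/-- The witness coefficient `A(a,b) = b⁻¹` (Lean's total inverse: `0⁻¹ = 0`). -/
def invY : (Fin 2 → ℝ) → ℝ := fun p => (p 1)⁻¹

/-- The vertical fibre derivative of `invY` is `−1/b²` (everywhere, by Mathlib's conventions). -/
theorem deriv_invY (p : Fin 2 → ℝ) : deriv (fun s : ℝ => invY ![p 0, s]) (p 1) = -((p 1) ^ 2)⁻¹ := by
  have : (fun s : ℝ => invY ![p 0, s]) = fun s => s⁻¹ := by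
    funext s; simp [invY]
  rw [this, deriv_inv]

/-- The bulk of the witness in the stub's shape is `𝟙_{Δ°} · (−1/b²)`. -/
theorem bulk_invY_eq : (fun p : Fin 2 → ℝ => if 0 < p 0 ∧ 0 < p 1 ∧ p 0 + p 1 < 1
      then deriv (fun s : ℝ => invY ![p 0, s]) (p 1) else 0) =
    fun p => if 0 < p 0 ∧ 0 < p 1 ∧ p 0 + p 1 < 1 then -((p 1) ^ 2)⁻¹ else 0 := by
  funext p
  rw [deriv_invY]

/-- `invY` is `ℚ`-semialgebraic on the closed triangle (`1/y` on `{y > 0}`, `0` on `{y = 0}`). -/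
theorem isSemialgebraicFunOn_invY :
    IsSemialgebraicFunOn ℚ {p : Fin 2 → ℝ | 0 ≤ p 0 ∧ 0 ≤ p 1 ∧ p 0 + p 1 ≤ 1} invY := by
  set T : Set (Fin 2 → ℝ) := {p : Fin 2 → ℝ | 0 ≤ p 0 ∧ 0 ≤ p 1 ∧ p 0 + p 1 ≤ 1} with hT
  have hTs : IsSemialgebraic ℚ T := isSemialgebraic_closedTriangle'
  have hpos : IsSemialgebraic ℚ {x : Fin 2 → ℝ | 0 < x 1} := by
    simpa using isSemialgebraic_setOf_eval_lt (k := ℚ) (R := ℝ) (ι := Fin 2) (C 0) (X 1)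
  have hle : IsSemialgebraic ℚ {x : Fin 2 → ℝ | x 1 ≤ 0} := by
    simpa using isSemialgebraic_setOf_eval_le (k := ℚ) (R := ℝ) (ι := Fin 2) (X 1) (C 0)
  have h1 : IsSemialgebraicFunOn ℚ (T ∩ {x : Fin 2 → ℝ | 0 < x 1}) invY := by
    refine (isSemialgebraicFunOn_aeval_div_aeval (hTs.inter hpos) (1 : MvPolynomial (Fin 2) ℚ) (X 1)
      fun x hx => ?_).congr fun x _ => ?_
    · have : (0 : ℝ) < x 1 := hx.2
      simpa using this.ne'
    · simp [invY]
  have h2 : IsSemialgebraicFunOn ℚ (T ∩ {x : Fin 2 → ℝ | x 1 ≤ 0}) invY := by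
    refine (isSemialgebraicFunOn_natCast (hTs.inter hle) 0).congr fun x hx => ?_
    have hx0 : x 1 = 0 := le_antisymm hx.2 hx.1.2.1
    simp [invY, hx0]
  have hU : T ∩ {x : Fin 2 → ℝ | 0 < x 1} ∪ T ∩ {x : Fin 2 → ℝ | x 1 ≤ 0} = T := by
    rw [← inter_union_distrib_left]
    refine inter_eq_left.mpr fun x _ => ?_
    simp only [mem_union, mem_setOf_eq]
    exact lt_or_ge 0 (x 1)
  rw [← hU]
  exact h1.union h2 (fun _ _ => rfl) (fun _ _ => rfl)

/-- The bulk `𝟙_{Δ°} · (−1/b²)` is `ℚ`-semialgebraic on the closed triangle. -/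
theorem isSemialgebraicFunOn_bulk_invY :
    IsSemialgebraicFunOn ℚ {p : Fin 2 → ℝ | 0 ≤ p 0 ∧ 0 ≤ p 1 ∧ p 0 + p 1 ≤ 1}
      (fun p => if 0 < p 0 ∧ 0 < p 1 ∧ p 0 + p 1 < 1 then -((p 1) ^ 2)⁻¹ else 0) := by
  set T : Set (Fin 2 → ℝ) := {p : Fin 2 → ℝ | 0 ≤ p 0 ∧ 0 ≤ p 1 ∧ p 0 + p 1 ≤ 1} with hT
  set O : Set (Fin 2 → ℝ) := {p : Fin 2 → ℝ | 0 < p 0 ∧ 0 < p 1 ∧ p 0 + p 1 < 1} with hO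
  have hTs : IsSemialgebraic ℚ T := isSemialgebraic_closedTriangle'
  have hOs : IsSemialgebraic ℚ O := isSemialgebraic_openTriangle
  have h1 : IsSemialgebraicFunOn ℚ (T ∩ O)
      (fun p => if 0 < p 0 ∧ 0 < p 1 ∧ p 0 + p 1 < 1 then -((p 1) ^ 2)⁻¹ else 0) := by
    refine (isSemialgebraicFunOn_aeval_div_aeval (hTs.inter hOs) (C (-1) : MvPolynomial (Fin 2) ℚ)
      (X 1 ^ 2) fun x hx => ?_).congr fun x hx => ?_
    · have : (0 : ℝ) < x 1 := hx.2.2.1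
      simpa using this.ne'
    · have hxO : 0 < x 0 ∧ 0 < x 1 ∧ x 0 + x 1 < 1 := hx.2
      rw [if_pos hxO]
      simp [div_eq_mul_inv]
  have h2 : IsSemialgebraicFunOn ℚ (T ∩ Oᶜ)
      (fun p => if 0 < p 0 ∧ 0 < p 1 ∧ p 0 + p 1 < 1 then -((p 1) ^ 2)⁻¹ else 0) := by
    refine (isSemialgebraicFunOn_natCast (hTs.inter hOs.compl) 0).congr fun x hx => ?_
    have hxO : ¬ (0 < x 0 ∧ 0 < x 1 ∧ x 0 + x 1 < 1) := hx.2
    rw [if_neg hxO]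
    simp
  rw [← inter_union_compl T O]
  exact h1.union h2 (fun _ _ => rfl) (fun _ _ => rfl)

/-! ## `∫_Δ b⁻² = ∞`: the boxes `[¼,½] × (ε/2, ε]` -/

/-- The test box `[¼,½] × (ε/2, ε]`. -/
def box (ε : ℝ) : Set (Fin 2 → ℝ) := Set.pi univ ![Icc (1/4 : ℝ) (1/2), Ioc (ε/2) ε]

/-- Membership in the test box. -/
theorem mem_box {ε : ℝ} {x : Fin 2 → ℝ} :
    x ∈ box ε ↔ (1/4 ≤ x 0 ∧ x 0 ≤ 1/2) ∧ (ε/2 < x 1 ∧ x 1 ≤ ε) := by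
  simp [box, Set.mem_pi, Fin.forall_fin_two]

/-- The test box is measurable. -/
theorem measurableSet_box (ε : ℝ) : MeasurableSet (box ε) :=
  MeasurableSet.univ_pi fun i => by fin_cases i <;> simp [measurableSet_Icc, measurableSet_Ioc]

/-- The area of the test box is `ε/8`. -/
theorem volume_box (ε : ℝ) : volume (box ε) = ENNReal.ofReal (ε / 8) := by
  rw [box, volume_pi_pi]
  simp only [Fin.prod_univ_two, Matrix.cons_val_zero, Matrix.cons_val_one, Matrix.cons_val_fin_one,
    Real.volume_Icc, Real.volume_Ioc]
  rw [← ENNReal.ofReal_mul (by norm_num)]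
  congr 1
  ring

/-- For `0 < ε ≤ ¼` the test box lies in the open (hence in the closed) triangle. -/
theorem box_subset_open {ε : ℝ} (hε : 0 < ε) (hε' : ε ≤ 1/4) :
    box ε ⊆ {p : Fin 2 → ℝ | 0 < p 0 ∧ 0 < p 1 ∧ p 0 + p 1 < 1} := by
  intro x hx
  rw [mem_box] at hx
  refine ⟨by linarith [hx.1.1], by linarith [hx.2.1], by linarith [hx.1.2, hx.2.2]⟩

/-- For `0 < ε ≤ ¼` the test box lies in the closed triangle. -/
theorem box_subset_closed {ε : ℝ} (hε : 0 < ε) (hε' : ε ≤ 1/4) :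
    box ε ⊆ {p : Fin 2 → ℝ | 0 ≤ p 0 ∧ 0 ≤ p 1 ∧ p 0 + p 1 ≤ 1} := fun x hx => by
  obtain ⟨h0, h1, h2⟩ := box_subset_open hε hε' hx
  exact ⟨h0.le, h1.le, h2.le⟩

/-- On the test box the bulk has size `≥ ε⁻²`. -/
theorem enorm_bulk_ge {ε : ℝ} (hε : 0 < ε) (hε' : ε ≤ 1/4) {x : Fin 2 → ℝ} (hx : x ∈ box ε) :
    ENNReal.ofReal ((ε ^ 2)⁻¹) ≤
      ‖(fun p : Fin 2 → ℝ => if 0 < p 0 ∧ 0 < p 1 ∧ p 0 + p 1 < 1 then -((p 1) ^ 2)⁻¹ else 0) x‖ₑ := by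
  have hxO : 0 < x 0 ∧ 0 < x 1 ∧ x 0 + x 1 < 1 := box_subset_open hε hε' hx
  rw [mem_box] at hx
  have hx1 : 0 < x 1 := hxO.2.1
  show ENNReal.ofReal ((ε ^ 2)⁻¹) ≤ ‖(if 0 < x 0 ∧ 0 < x 1 ∧ x 0 + x 1 < 1 then -((x 1) ^ 2)⁻¹ else 0)‖ₑ
  rw [if_pos hxO, Real.enorm_eq_ofReal_abs, abs_neg, abs_of_pos (inv_pos.mpr (pow_pos hx1 2))]
  refine ENNReal.ofReal_le_ofReal ?_
  rw [inv_le_inv₀ (pow_pos hε 2) (pow_pos hx1 2)]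
  exact pow_le_pow_left₀ hx1.le hx.2.2 2

/-- The mass of the bulk on the test box is at least `1/(8ε)`. -/
theorem mass_box_ge {ε : ℝ} (hε : 0 < ε) (hε' : ε ≤ 1/4) :
    ENNReal.ofReal (1 / (8 * ε)) ≤ ∫⁻ x in box ε,
      ‖(fun p : Fin 2 → ℝ => if 0 < p 0 ∧ 0 < p 1 ∧ p 0 + p 1 < 1 then -((p 1) ^ 2)⁻¹ else 0) x‖ₑ := by
  calc ENNReal.ofReal (1 / (8 * ε))
      = ENNReal.ofReal ((ε ^ 2)⁻¹) * volume (box ε) := by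
        rw [volume_box ε, ← ENNReal.ofReal_mul (by positivity)]
        congr 1
        field_simp
    _ = ∫⁻ _ in box ε, ENNReal.ofReal ((ε ^ 2)⁻¹) := (setLIntegral_const _ _).symm
    _ ≤ _ := setLIntegral_mono' (measurableSet_box ε) fun x hx => enorm_bulk_ge hε hε' hx

/-- The bulk `𝟙_{Δ°} · (−1/b²)` is NOT integrable on the closed triangle. -/
theorem not_integrableOn_bulk_invY : ¬ IntegrableOn
    (fun p : Fin 2 → ℝ => if 0 < p 0 ∧ 0 < p 1 ∧ p 0 + p 1 < 1 then -((p 1) ^ 2)⁻¹ else 0)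
    {p : Fin 2 → ℝ | 0 ≤ p 0 ∧ 0 ≤ p 1 ∧ p 0 + p 1 ≤ 1} volume := by
  intro hInt
  set L : ℝ≥0∞ := ∫⁻ x in {p : Fin 2 → ℝ | 0 ≤ p 0 ∧ 0 ≤ p 1 ∧ p 0 + p 1 ≤ 1},
    ‖(fun p : Fin 2 → ℝ => if 0 < p 0 ∧ 0 < p 1 ∧ p 0 + p 1 < 1 then -((p 1) ^ 2)⁻¹ else 0) x‖ₑ with hL
  have hLfin : L < ⊤ := hInt.2
  have hbound : ∀ ε : ℝ, 0 < ε → ε ≤ 1/4 → 1 / (8 * ε) ≤ L.toReal := by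
    intro ε hε hε'
    have h1 := (mass_box_ge hε hε').trans (lintegral_mono_set (μ := volume)
      (f := fun x => ‖(fun p : Fin 2 → ℝ => if 0 < p 0 ∧ 0 < p 1 ∧ p 0 + p 1 < 1
        then -((p 1) ^ 2)⁻¹ else 0) x‖ₑ) (box_subset_closed hε hε'))
    exact (ENNReal.ofReal_le_iff_le_toReal hLfin.ne).mp h1
  set ε : ℝ := 1 / (8 * (L.toReal + 1)) with hε
  have hpos : 0 < L.toReal + 1 := by positivity
  have hε0 : 0 < ε := by rw [hε]; positivity
  have hε1 : ε ≤ 1/4 := by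
    rw [hε, div_le_div_iff₀ (by positivity) (by norm_num)]
    nlinarith [ENNReal.toReal_nonneg (a := L)]
  have h := hbound ε hε0 hε1
  have : 1 / (8 * ε) = L.toReal + 1 := by
    rw [hε]
    field_simp
  linarith

/-- **Continuity (boundedness) of `A` is load-bearing in `stub_derivIntegrable`.** With
`ContinuousOn A Δ` deleted the statement is false: `A = 1/y` is `ℚ`-semialgebraic on `Δ`, its bulk
`∂_b A = −1/y²` (extended by `0`) is `ℚ`-semialgebraic on `Δ`, and it is not integrable. -/
theorem not_derivIntegrableWithoutContinuity : ¬ DerivIntegrableWithoutContinuity := by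
  intro h
  have h1 := h invY isSemialgebraicFunOn_invY (by rw [bulk_invY_eq]; exact isSemialgebraicFunOn_bulk_invY)
  rw [bulk_invY_eq] at h1
  exact not_integrableOn_bulk_invY h1

/-! ## The potential is load-bearing in `stub_mixedPartials` -/

/-- `stub_mixedPartials` with the potential hypothesis
`∀ p ∈ Δ°, HasFDerivAt S (A p • proj 0 + B p • proj 1) p` DELETED (and the then unused `S` dropped;
verbatim otherwise). -/
def MixedPartialsWithoutPotential : Prop := ∀ (A B : (Fin 2 → ℝ) → ℝ),
    IsSemialgebraicFunOn ℚ {p : Fin 2 → ℝ | 0 ≤ p 0 ∧ 0 ≤ p 1 ∧ p 0 + p 1 ≤ 1} A →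
    IsSemialgebraicFunOn ℚ {p : Fin 2 → ℝ | 0 ≤ p 0 ∧ 0 ≤ p 1 ∧ p 0 + p 1 ≤ 1} B →
    ∃ Z : Set (Fin 2 → ℝ), IsSemialgebraic ℚ Z ∧ volume Z = 0 ∧
      ∀ p : Fin 2 → ℝ, 0 < p 0 → 0 < p 1 → p 0 + p 1 < 1 → p ∉ Z →
        HasDerivAt (fun s : ℝ => A ![p 0, s]) (deriv (fun s : ℝ => A ![p 0, s]) (p 1)) (p 1) ∧
        HasDerivAt (fun s : ℝ => B ![s, p 1]) (deriv (fun s : ℝ => A ![p 0, s]) (p 1)) (p 0)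

/-- A null set misses a point of the test box `[¼,½] × (⅛,¼]` (area `1/32`). -/
theorem exists_mem_box_not_mem {Z : Set (Fin 2 → ℝ)} (hZ : volume Z = 0) :
    ∃ p ∈ box (1/4), p ∉ Z := by
  by_contra hcon
  have hsub : box (1/4 : ℝ) ⊆ Z := fun p hp => by
    by_contra hpZ
    exact hcon ⟨p, hp, hpZ⟩
  have h0 : volume (box (1/4 : ℝ)) = 0 := measure_mono_null hsub hZ
  rw [volume_box, ENNReal.ofReal_eq_zero] at h0
  norm_num at h0

/-- **The potential is load-bearing in `stub_mixedPartials`.** For `A = y`, `B = 0` (both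
`ℚ`-semialgebraic on `Δ`, no common potential) the conclusion fails at every point of the open
triangle: `∂_b A = 1` but `a ↦ B(a,b) = 0` has derivative `0`. -/
theorem not_mixedPartialsWithoutPotential : ¬ MixedPartialsWithoutPotential := by
  intro h
  have hA : IsSemialgebraicFunOn ℚ {p : Fin 2 → ℝ | 0 ≤ p 0 ∧ 0 ≤ p 1 ∧ p 0 + p 1 ≤ 1}
      (fun p : Fin 2 → ℝ => p 1) := isSemialgebraicFunOn_apply isSemialgebraic_closedTriangle' 1
  have hB : IsSemialgebraicFunOn ℚ {p : Fin 2 → ℝ | 0 ≤ p 0 ∧ 0 ≤ p 1 ∧ p 0 + p 1 ≤ 1}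
      (fun _ : Fin 2 → ℝ => (0 : ℝ)) := by
    simpa using isSemialgebraicFunOn_natCast isSemialgebraic_closedTriangle' 0
  obtain ⟨Z, _, hZ0, hZ⟩ := h (fun p => p 1) (fun _ => 0) hA hB
  obtain ⟨p, hp, hpZ⟩ := exists_mem_box_not_mem hZ0
  have hpO : 0 < p 0 ∧ 0 < p 1 ∧ p 0 + p 1 < 1 := box_subset_open (by norm_num) le_rfl hp
  have h2 := (hZ p hpO.1 hpO.2.1 hpO.2.2 hpZ).2
  have e1 : (fun s : ℝ => (fun q : Fin 2 → ℝ => q 1) ![p 0, s]) = fun s => s := by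
    funext s; simp
  have hd : deriv (fun s : ℝ => (fun q : Fin 2 → ℝ => q 1) ![p 0, s]) (p 1) = 1 := by
    rw [e1]; exact deriv_id (p 1)
  have h2' : HasDerivAt (fun _ : ℝ => (0 : ℝ)) (1 : ℝ) (p 0) := by
    have := h2
    rw [hd] at this
    exact this
  have := (hasDerivAt_const (p 0) (0 : ℝ)).unique h2'
  exact zero_ne_one this

end Summit.KontsevichZagierPeriods.PlanarAreas.Negative.GreenBands

end
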